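import Literature.Barriers.ABC.BakerMethodBoundsStewartTijdemanGenericProofs
import HarnessLib

/-!
# Cell abc-stewartyu: the prime-argument `p`-adic SOCKET of the abc assembly, I —
# absorption lemmas, the endgame with a power of `log c`, and the localized summation

`Summits/ABC/StewartYu/PrimePadicSocketTools.lean` — cell `abc-stewartyu` (HOME
`run/shared/lean/pub/abc-stewartyu/`, seat p3; theorems only: no definition, no named fact), continuing
the tree's `Literature/Barriers/ABC/BakerMethodBoundsStewartTijdemanGenericProofs.lean`, whose Theorem A
(`stewartTijdeman1986_of_primePadicBound`) derives the Stewart–Tijdeman shape `BakerShapeBound 15 0`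
(`log c ≤ κ R^{15}` [cite: StewartTijdeman1986, Theorem 1 (upper bound), as quoted in
Waldschmidt2014 §2 (PDF p. 3)]) from ANY `p`-adic bound for linear forms in the logarithms of
distinct rational primes of the shape `K Lⁿ n^{κn} p^σ (∏ log qᵢ) (log max(3, max|eᵢ|))^τ` with
`κ, σ ≤ 14` and a FIXED `τ`.

This file and its sequels (`PrimePadicSocketLog.lean`, `PrimePadicSocketRad.lean`, `PrimePadicSocket.lean`)
widen that socket to the shapes a first formalisation of the `p`-adic theory is likely to produce:
any `κ, σ ≥ 0`, a power of the logarithm GROWING WITH `n` (`τ₀ + τ₁ n`, the quality of Baker's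
method without Kummer descent), and the stray terms `log p`, `∑ log qᵢ` inside that logarithm
(shapes like `Ω log Ω (log B + log Ω)` of Cijsouw–Waldschmidt 1977 or `log(Bₙ C₅ p^{n+1} ∏ h')` of
Yu 2007). Here: the tools.

* `pow_le_pow_mul_factorial_mul_exp` — `Xⁿ ≤ δ^{-n} n! e^{δX}` (from `sⁿ ≤ n! · e^s`, one term of
  the exponential series — the device that absorbs `(log R)^n` and `(log log c)^n` against `n! ≤ rad`,
  `factorial_card_le_prod`); `log_pow_le_mul_rpow` — `(log Y)^τ ≤ ((τ+1)/δ)^τ · Y^δ` (`Y ≥ 1`);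
* `bakerShapeBound_zero_mono` — `BakerShapeBound θ 0 → BakerShapeBound θ' 0` for `θ ≤ θ'`;
* `bakerShapeBound_of_loglog_rpow` — the endgame: `log c ≤ M R^μ Y^δ (log Y)^τ`, `Y = max(3, log c)`,
  with `2δ < 1` and `μ ≤ θ (1 − 2δ)`, gives `BakerShapeBound θ 0`;
* `sum_padicPart_le_of_local` — the Stewart–Tijdeman summation with a COMPLETELY GENERIC per-prime
  bound `F p`: if `ord_p((y/z)² − 1) ≤ F p` for the primes `p ≥ p₀` of `x` (asked only for the
  enumerations of the primes of `yz` and exponent vectors with entries `≤ 3 log max(y, z)` in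
  absolute value), then `∑_{p ∣ x, p ≥ p₀} ord_p(x) log p ≤ ∑_{p ∣ x, p ≥ p₀} F p · log p`.

Nothing here is claimed to be in print beyond the summation pattern of Stewart–Tijdeman 1986 /
Shorey–Tijdeman [cite: ShoreyTijdeman1986, Ch. 1, proof of Theorem 1.2 (PDF p. 48)]; the point is to
record, as kernel theorems, WHICH crude `p`-adic bounds already yield an abc-type bound.

## References

* [StewartTijdeman1986] C. L. Stewart, R. Tijdeman, *On the Oesterlé–Masser conjecture*, Monatsh.
  Math. 102 (1986), 251–257 — Theorem 1, as quoted in [Waldschmidt2014] §2.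
* [ShoreyTijdeman1986] T. N. Shorey, R. Tijdeman, *Exponential Diophantine Equations*, Cambridge
  Tracts in Math. 87, CUP 1986 — Ch. B; Ch. 1, Theorem 1.2 and its proof.
-/


noncomputable section

open Finset Real
open Literature.NumberTheory.DiophantineGeometry

namespace Summit.ABC.StewartYu

open Literature.Barriers.ABC Literature.Barriers.ABC.StewartTijdemanGeneric


/-! ### Absorption lemmas -/

/-- `(log Y)^τ ≤ ((τ+1)/δ)^τ · Y^δ` for `Y ≥ 1` and `δ > 0` (`log Y ≤ Y^ε/ε` with
`ε = δ/(τ+1)`). [folklore] -/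
theorem log_pow_le_mul_rpow {δ : ℝ} (hδ : 0 < δ) (τ : ℕ) {Y : ℝ} (hY : 1 ≤ Y) :
    Real.log Y ^ τ ≤ ((τ + 1) / δ) ^ τ * Y ^ δ := by
  have hY0 : 0 ≤ Y := zero_le_one.trans hY
  set ε : ℝ := δ / ((τ : ℝ) + 1) with hε
  have hτ1 : (0 : ℝ) < (τ : ℝ) + 1 := by positivity
  have hε0 : 0 < ε := by rw [hε]; positivity
  have h1 : Real.log Y ≤ Y ^ ε / ε := Real.log_le_rpow_div hY0 hε0
  have h2 : Y ^ ε / ε = ((τ + 1) / δ) * Y ^ ε := by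
    rw [hε]; field_simp
  have hlog0 : 0 ≤ Real.log Y := Real.log_nonneg hY
  have hc0 : (0 : ℝ) ≤ (τ + 1) / δ := by positivity
  calc Real.log Y ^ τ ≤ (((τ + 1) / δ) * Y ^ ε) ^ τ := by
        rw [← h2]; exact pow_le_pow_left₀ hlog0 h1 τ
    _ = ((τ + 1) / δ) ^ τ * Y ^ (ε * τ) := by rw [mul_pow, ← Real.rpow_mul_natCast hY0]
    _ ≤ ((τ + 1) / δ) ^ τ * Y ^ δ := by
        apply mul_le_mul_of_nonneg_left _ (pow_nonneg hc0 τ)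
        apply Real.rpow_le_rpow_of_exponent_le hY
        rw [hε, div_mul_eq_mul_div, div_le_iff₀ hτ1]
        have : (τ : ℝ) ≤ τ + 1 := by linarith
        nlinarith

/-- `Xⁿ ≤ Cⁿ · n! · e^{δ X}` for `X ≥ 0`, `δ > 0`, with `C = 1/δ` (`(δX)ⁿ ≤ n! e^{δX}`). [folklore] -/
theorem pow_le_pow_mul_factorial_mul_exp {δ X : ℝ} (hδ : 0 < δ) (hX : 0 ≤ X) (n : ℕ) :
    X ^ n ≤ (1 / δ) ^ n * (n.factorial : ℝ) * Real.exp (δ * X) := by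
  -- `(δX)ⁿ ≤ n! e^{δX}`: one term of the exponential series (the tree has this as
  -- `Literature.NumberTheory.Sieve.Iwaniec1980b.pow_le_factorial_mul_exp`; re-derived in two lines
  -- from Mathlib to keep the sieve files out of the import closure).
  have h : (δ * X) ^ n ≤ (n.factorial : ℝ) * Real.exp (δ * X) := by
    have h0 := Real.pow_div_factorial_le_exp (δ * X) (by positivity) n
    have hf : (0 : ℝ) < n.factorial := by exact_mod_cast Nat.factorial_pos n
    rw [div_le_iff₀ hf] at h0
    linarith [h0]
  have hδn : (0 : ℝ) < δ ^ n := pow_pos hδ n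
  rw [mul_pow] at h
  calc X ^ n = (1 / δ) ^ n * (δ ^ n * X ^ n) := by
        rw [← mul_assoc, ← mul_pow, one_div, inv_mul_cancel₀ hδ.ne', one_pow, one_mul]
    _ ≤ (1 / δ) ^ n * ((n.factorial : ℝ) * Real.exp (δ * X)) :=
        mul_le_mul_of_nonneg_left h (pow_nonneg (by positivity) n)
    _ = _ := by ring

/-! ### Monotonicity of the shape in the exponent -/

/-- `BakerShapeBound θ 0 → BakerShapeBound θ' 0` for `θ ≤ θ'` (`R ≥ 1`). [folklore] -/
theorem bakerShapeBound_zero_mono {θ θ' : ℝ} (hθ : θ ≤ θ') (h : BakerShapeBound θ 0) :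
    BakerShapeBound θ' 0 := by
  obtain ⟨κ, hκ⟩ := h
  refine ⟨max κ 0, fun a b c ht => ?_⟩
  have h1 := hκ a b c ht
  have hR : (1 : ℝ) ≤ (rad a b c : ℝ) := one_le_rad_real a b c
  rw [pow_zero, mul_one] at h1 ⊢
  calc Real.log c ≤ κ * (rad a b c : ℝ) ^ θ := h1
    _ ≤ max κ 0 * (rad a b c : ℝ) ^ θ :=
        mul_le_mul_of_nonneg_right (le_max_left _ _) (Real.rpow_nonneg (by linarith) θ)
    _ ≤ max κ 0 * (rad a b c : ℝ) ^ θ' :=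
        mul_le_mul_of_nonneg_left (Real.rpow_le_rpow_of_exponent_le hR hθ) (le_max_right _ _)

/-! ### The endgame with a small power of `log c` -/

/-- **The endgame, with a power `Y^δ`.** If every abc triple satisfies
`log c ≤ M · R^μ · Y^δ · (log Y)^τ`, `Y = max(3, log c)`, with `0 < δ`, `2δ < 1`, `0 ≤ μ ≤ θ(1 − 2δ)`,
then `BakerShapeBound θ 0` (`(log Y)^τ ≤ C Y^δ`, then `u ≤ (3 + M')u^{2δ}` for `u = 3 + log c` gives
`u ≤ (3 + M')^{1/(1−2δ)}` and `R^{μ/(1−2δ)} ≤ R^θ`). [folklore] -/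
theorem bakerShapeBound_of_loglog_rpow {μ θ δ M : ℝ} {τ : ℕ} (hμ0 : 0 ≤ μ) (hδ : 0 < δ)
    (h2δ : 2 * δ < 1) (hθ : μ ≤ θ * (1 - 2 * δ)) (hM : 0 ≤ M)
    (h : ∀ a b c : ℕ, IsABCTriple a b c →
      Real.log c ≤ M * (rad a b c : ℝ) ^ μ * (max 3 (Real.log c)) ^ δ *
        Real.log (max 3 (Real.log c)) ^ τ) :
    BakerShapeBound θ 0 := by
  set Cτ : ℝ := ((τ + 1) / δ) ^ τ with hCτ
  have hCτ0 : 0 ≤ Cτ := pow_nonneg (by positivity) τ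
  set γ : ℝ := 1 - 2 * δ with hγ
  have hγ0 : 0 < γ := by rw [hγ]; linarith
  have hθ0 : 0 ≤ θ := by
    by_contra hneg
    push Not at hneg
    have : θ * (1 - 2 * δ) < 0 := mul_neg_of_neg_of_pos hneg hγ0
    linarith
  set κ₀ : ℝ := (3 + M * Cτ * 3) ^ (1 / γ) with hκ₀
  refine ⟨κ₀, fun a b c ht => ?_⟩
  have hmain := h a b c ht
  obtain ⟨ha, hb, habc, -⟩ := ht
  rw [pow_zero, mul_one]
  set R : ℝ := (rad a b c : ℝ) with hR
  have hR1 : 1 ≤ R := one_le_rad_real a b c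
  set y : ℝ := Real.log c with hy
  have hc1 : (1 : ℝ) ≤ c := by exact_mod_cast (show 1 ≤ c by omega)
  have hy0 : 0 ≤ y := Real.log_nonneg hc1
  set Y : ℝ := max 3 y with hYdef
  have hY1 : 1 ≤ Y := le_trans (by norm_num) (le_max_left _ _)
  have hY0 : 0 ≤ Y := zero_le_one.trans hY1
  have hY3 : Y ≤ 3 + y := max_le (by linarith) (by linarith)
  set u : ℝ := 3 + y with hu
  have hu1 : 1 ≤ u := by rw [hu]; linarith
  have hu0 : 0 ≤ u := zero_le_one.trans hu1
  -- `y ≤ M' u^{2δ}`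
  set M' : ℝ := M * Cτ * 3 * R ^ μ with hM'
  have hRμ1 : 1 ≤ R ^ μ := Real.one_le_rpow hR1 hμ0
  have hM'0 : 0 ≤ M' := by rw [hM']; positivity
  have h1 : y ≤ M' * u ^ (2 * δ) := by
    have hlog := log_pow_le_mul_rpow hδ τ hY1
    have hYu : Y ^ δ ≤ u ^ δ := Real.rpow_le_rpow hY0 hY3 hδ.le
    have hYu2 : Y ^ δ * Y ^ δ ≤ u ^ (2 * δ) := by
      rw [two_mul, Real.rpow_add (by linarith : (0 : ℝ) < u)]
      exact mul_le_mul hYu hYu (Real.rpow_nonneg hY0 δ) (Real.rpow_nonneg hu0 δ)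
    calc y ≤ M * R ^ μ * Y ^ δ * Real.log Y ^ τ := hmain
      _ ≤ M * R ^ μ * Y ^ δ * (Cτ * Y ^ δ) :=
          mul_le_mul_of_nonneg_left hlog (by positivity)
      _ = M * Cτ * R ^ μ * (Y ^ δ * Y ^ δ) := by ring
      _ ≤ M * Cτ * R ^ μ * u ^ (2 * δ) := mul_le_mul_of_nonneg_left hYu2 (by positivity)
      _ ≤ M' * u ^ (2 * δ) := by
          rw [hM']
          have : M * Cτ * R ^ μ ≤ M * Cτ * 3 * R ^ μ := by nlinarith [mul_nonneg hM hCτ0]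
          exact mul_le_mul_of_nonneg_right this (Real.rpow_nonneg hu0 _)
  -- `u ≤ (3 + M') u^{2δ}`, so `u^{γ} ≤ 3 + M'`
  have hu2δ : 1 ≤ u ^ (2 * δ) := Real.one_le_rpow hu1 (by linarith)
  have h2 : u ≤ (3 + M') * u ^ (2 * δ) := by
    calc u = 3 + y := rfl
      _ ≤ 3 * u ^ (2 * δ) + M' * u ^ (2 * δ) := by nlinarith
      _ = (3 + M') * u ^ (2 * δ) := by ring
  have h3 : u ^ γ ≤ 3 + M' := by
    have hsplit : u = u ^ γ * u ^ (2 * δ) := by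
      rw [← Real.rpow_add (by linarith : (0 : ℝ) < u), hγ]; norm_num
    have hpos : 0 < u ^ (2 * δ) := by linarith
    rw [hsplit] at h2
    exact le_of_mul_le_mul_right (by linarith [h2]) hpos
  -- `u ≤ (3 + M')^{1/γ} ≤ κ₀ R^{θ}`
  have h4 : u ≤ (3 + M') ^ (1 / γ) := by
    have h := Real.rpow_le_rpow (Real.rpow_nonneg hu0 _) h3 (by positivity : (0:ℝ) ≤ 1 / γ)
    rwa [← Real.rpow_mul hu0, mul_one_div_cancel hγ0.ne', Real.rpow_one] at h
  have h5 : (3 + M') ^ (1 / γ) ≤ κ₀ * R ^ θ := by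
    have hle : 3 + M' ≤ (3 + M * Cτ * 3) * R ^ μ := by
      rw [hM']; nlinarith [mul_nonneg (mul_nonneg hM hCτ0) (by norm_num : (0:ℝ) ≤ 3)]
    calc (3 + M') ^ (1 / γ) ≤ ((3 + M * Cτ * 3) * R ^ μ) ^ (1 / γ) :=
          Real.rpow_le_rpow (by linarith) hle (by positivity)
      _ = κ₀ * (R ^ μ) ^ (1 / γ) := by
          rw [hκ₀, Real.mul_rpow (by positivity) (by positivity)]
      _ = κ₀ * R ^ (μ * (1 / γ)) := by rw [← Real.rpow_mul (by linarith)]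
      _ ≤ κ₀ * R ^ θ := by
          apply mul_le_mul_of_nonneg_left _ (by positivity)
          apply Real.rpow_le_rpow_of_exponent_le hR1
          rw [mul_one_div, div_le_iff₀ hγ0, hγ]
          exact hθ
  calc y ≤ u := by rw [hu]; linarith
    _ ≤ κ₀ * R ^ θ := h4.trans h5

/-! ### The Stewart–Tijdeman summation with a generic per-prime bound -/

/-- **The Stewart–Tijdeman summation, localized generic form.** Let `y ≠ z` be coprime positive
integers, `S` the set of primes of `yz` (`n = #S`), and `x` a positive integer coprime to `yz` with
`x ∣ y² − z²`. Suppose that for every prime `p ≥ p₀` dividing `x`, for the enumerations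
`q : Fin n → ℕ` of `S` (injective, image `S`, `qᵢ ≠ p`) and every exponent vector `e ≠ 0` with
`∏ qᵢ^{eᵢ} ≠ 1` and `max |eᵢ| ≤ 3 log max(y, z)`, one has `ord_p(∏ qᵢ^{eᵢ} − 1) ≤ F p` for some
function `F`. Then `∑_{p ∣ x, p ≥ p₀} ord_p(x) log p ≤ ∑_{p ∣ x, p ≥ p₀} F p · log p` (apply the
hypothesis to `(y/z)² − 1 = ∏_{q ∈ S} q^{2e_q} − 1`, `e_q = ord_q y − ord_q z`, whose `p`-order is
`≥ ord_p x`). This is `sum_padicPart_le` with the shape of the bound left to the caller. [folklore] -/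
theorem sum_padicPart_le_of_local (F : ℕ → ℝ) {p₀ x y z : ℕ} (hx : 0 < x) (hy : 0 < y)
    (hz : 0 < z) (hyz : y ≠ z) (hcop : Nat.Coprime y z) (hxcop : Nat.Coprime x (y * z))
    (hdvd : (x : ℤ) ∣ (y : ℤ) ^ 2 - (z : ℤ) ^ 2)
    (hP : ∀ (p : ℕ) (q : Fin (y * z).primeFactors.card → ℕ)
      (e : Fin (y * z).primeFactors.card → ℤ), p.Prime → p₀ ≤ p → p ∣ x →
      (∀ i, (q i).Prime) → Function.Injective q →
      Finset.univ.image q = (y * z).primeFactors → (∀ i, q i ≠ p) → e ≠ 0 →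
      ∏ i, ((q i : ℚ)) ^ e i ≠ 1 →
      (((Finset.univ.sup fun i => (e i).natAbs : ℕ)) : ℝ) ≤ 3 * Real.log (max y z : ℕ) →
      (padicValRat p (∏ i, ((q i : ℚ)) ^ e i - 1) : ℝ) ≤ F p) :
    ∑ p ∈ x.primeFactors.filter (fun p => p₀ ≤ p), (x.factorization p : ℝ) * Real.log p ≤
      ∑ p ∈ x.primeFactors.filter (fun p => p₀ ≤ p), F p * Real.log p := by
  classical
  have hy0 : y ≠ 0 := hy.ne'
  have hz0 : z ≠ 0 := hz.ne'
  have hx0 : x ≠ 0 := hx.ne'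
  set S := (y * z).primeFactors with hS
  set n := S.card with hn
  have hprime : ∀ q ∈ S, q.Prime := fun q hq => Nat.prime_of_mem_primeFactors hq
  -- the exponent vector and the `Fin n`-indexed family of primes
  set e : ℕ → ℤ := fun q => (y.factorization q : ℤ) - (z.factorization q : ℤ) with he
  set φ : Fin n ≃ S := S.equivFin.symm with hφ
  set q : Fin n → ℕ := fun i => (φ i : ℕ) with hqdef
  set e' : Fin n → ℤ := fun i => 2 * e (q i) with he'
  have hqS : ∀ i, q i ∈ S := fun i => (φ i).2
  have hqP : ∀ i, (q i).Prime := fun i => hprime _ (hqS i)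
  have hinj : Function.Injective q := fun i j hij =>
    φ.injective (Subtype.ext hij)
  have himg : Finset.univ.image q = S := by
    ext r
    simp only [Finset.mem_image, Finset.mem_univ, true_and]
    constructor
    · rintro ⟨i, rfl⟩; exact hqS i
    · intro hr; exact ⟨φ.symm ⟨r, hr⟩, by simp [hqdef]⟩
  -- `S` is nonempty and every `e_q`, `q ∈ S`, is non-zero
  have hyz1 : 1 < y * z := by
    rcases Nat.lt_or_ge 1 y with h | h
    · nlinarith
    · have hy1 : y = 1 := by omega
      subst hy1
      have : 1 < z := by omega
      simpa using this
  have hSne : S.Nonempty := Nat.nonempty_primeFactors.mpr hyz1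
  have hn0 : 0 < n := Finset.card_pos.mpr hSne
  have he_ne : ∀ r ∈ S, e r ≠ 0 := by
    intro r hr
    have hrP := hprime r hr
    have hrdvd : r ∣ y * z := Nat.dvd_of_mem_primeFactors hr
    rcases (Nat.Prime.dvd_mul hrP).mp hrdvd with hry | hrz
    · have h1 : 0 < y.factorization r := hrP.factorization_pos_of_dvd hy0 hry
      have h2 : z.factorization r = 0 := by
        apply Nat.factorization_eq_zero_of_not_dvd
        intro hrz
        exact hrP.one_lt.ne' (Nat.eq_one_of_dvd_coprimes hcop hry hrz)
      simp only [he, h2]; omega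
    · have h1 : 0 < z.factorization r := hrP.factorization_pos_of_dvd hz0 hrz
      have h2 : y.factorization r = 0 := by
        apply Nat.factorization_eq_zero_of_not_dvd
        intro hry
        exact hrP.one_lt.ne' (Nat.eq_one_of_dvd_coprimes hcop hry hrz)
      simp only [he, h2]; omega
  have he'ne : e' ≠ 0 := by
    intro h0
    obtain ⟨i⟩ : Nonempty (Fin n) := ⟨⟨0, hn0⟩⟩
    have := congr_fun h0 i
    simp only [he', Pi.zero_apply, mul_eq_zero, OfNat.ofNat_ne_zero, false_or] at this
    exact he_ne _ (hqS i) this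
  -- `∏ q_i^{e'_i} = (y/z)²`
  have hfac : ∀ {m : ℕ}, m ≠ 0 → m ∣ y * z →
      (m : ℚ) = ∏ r ∈ S, (r : ℚ) ^ m.factorization r := by
    intro m hm hmd
    have h1 := Nat.prod_primeFactors_pow_factorization hm
    have hsub : m.primeFactors ⊆ S := Nat.primeFactors_mono hmd (mul_ne_zero hy0 hz0)
    rw [← Finset.prod_subset hsub (fun r hrS hr => ?_)]
    · exact_mod_cast h1
    · have hnd : ¬ r ∣ m := fun hd => hr (Nat.mem_primeFactors.mpr ⟨hprime r hrS, hd, hm⟩)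
      rw [Nat.factorization_eq_zero_of_not_dvd hnd, pow_zero]
  have hprodS : ∏ r ∈ S, (r : ℚ) ^ e r = (y : ℚ) / z := by
    rw [hfac hy0 (dvd_mul_right y z), hfac hz0 (dvd_mul_left z y), ← Finset.prod_div_distrib]
    refine Finset.prod_congr rfl fun r hr => ?_
    have hr0 : (r : ℚ) ≠ 0 := by exact_mod_cast (hprime r hr).ne_zero
    rw [he, zpow_sub₀ hr0, zpow_natCast, zpow_natCast]
  have hprod : ∏ i, ((q i : ℚ)) ^ e' i = ((y : ℚ) / z) ^ 2 := by
    have h1 : ∏ i, ((q i : ℚ)) ^ e' i = ∏ i, (((q i : ℚ)) ^ e (q i)) ^ 2 := by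
      refine Finset.prod_congr rfl fun i _ => ?_
      show ((q i : ℚ)) ^ (2 * e (q i)) = (((q i : ℚ)) ^ e (q i)) ^ 2
      rw [mul_comm, zpow_mul, zpow_ofNat]
    have h2 : ∏ i, (((q i : ℚ)) ^ e (q i)) ^ 2 = (∏ i, ((q i : ℚ)) ^ e (q i)) ^ 2 :=
      Finset.prod_pow _ 2 _
    have h3 : ∏ i, ((q i : ℚ)) ^ e (q i) = ∏ r ∈ S, (r : ℚ) ^ e r := by
      rw [← Finset.prod_coe_sort S (fun r => (r : ℚ) ^ e r)]
      exact Fintype.prod_equiv φ (fun i => ((q i : ℚ)) ^ e (q i)) (fun r => ((r : ℕ) : ℚ) ^ e r)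
        (fun i => rfl)
    rw [h1, h2, h3, hprodS]
  have hyzQ : (y : ℚ) / z ≠ 1 := by
    intro h
    rw [div_eq_one_iff_eq (by exact_mod_cast hz0)] at h
    exact hyz (by exact_mod_cast h)
  have hyzQ' : (y : ℚ) / z ≠ -1 := by
    intro h
    have : (0 : ℚ) < (y : ℚ) / z := div_pos (by exact_mod_cast hy) (by exact_mod_cast hz)
    rw [h] at this; norm_num at this
  have hne1 : ∏ i, ((q i : ℚ)) ^ e' i ≠ 1 := by
    rw [hprod]
    intro h
    rcases sq_eq_one_iff.mp h with h1 | h1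
    · exact hyzQ h1
    · exact hyzQ' h1
  -- the integer `m = y² − z² ≠ 0` and `(y/z)² − 1 = m / z²`
  set m : ℤ := (y : ℤ) ^ 2 - (z : ℤ) ^ 2 with hm
  have hm0 : m ≠ 0 := by
    intro h
    have h' : ((y : ℤ)) ^ 2 = (z : ℤ) ^ 2 := sub_eq_zero.mp h
    have h'' : y ^ 2 = z ^ 2 := by exact_mod_cast h'
    exact hyz (Nat.pow_left_injective (by norm_num) h'')
  have hΛ : ∏ i, ((q i : ℚ)) ^ e' i - 1 = (m : ℚ) / ((z : ℚ)) ^ 2 := by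
    rw [hprod, hm]; push_cast
    field_simp
  -- the sup of the exponents
  have hl2 : 0.6931471803 < Real.log 2 := Real.log_two_gt_d9
  have hsup : (((Finset.univ.sup fun i => (e' i).natAbs : ℕ)) : ℝ) ≤ 3 * Real.log (max y z : ℕ) := by
    obtain ⟨i, -, hi⟩ := Finset.exists_mem_eq_sup (Finset.univ : Finset (Fin n))
      (Finset.univ_nonempty_iff.mpr ⟨⟨0, hn0⟩⟩) (fun i => (e' i).natAbs)
    rw [hi]
    have hfy := factorization_mul_log_two_le (q := q i) (hqP i) hy0
    have hfz := factorization_mul_log_two_le (q := q i) (hqP i) hz0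
    have hly : Real.log y ≤ Real.log (max y z : ℕ) :=
      Real.log_le_log (by exact_mod_cast hy) (by exact_mod_cast le_max_left y z)
    have hlz : Real.log z ≤ Real.log (max y z : ℕ) :=
      Real.log_le_log (by exact_mod_cast hz) (by exact_mod_cast le_max_right y z)
    have hyf0 : (0 : ℝ) ≤ y.factorization (q i) := Nat.cast_nonneg _
    have hzf0 : (0 : ℝ) ≤ z.factorization (q i) := Nat.cast_nonneg _
    have hpy := mul_nonneg hyf0 (sub_nonneg.mpr hl2.le)
    have hpz := mul_nonneg hzf0 (sub_nonneg.mpr hl2.le)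
    rcases le_total (y.factorization (q i)) (z.factorization (q i)) with h | h
    · have h1 : (e' i).natAbs ≤ 2 * z.factorization (q i) := by
        simp only [he', he]; omega
      have h1' : ((e' i).natAbs : ℝ) ≤ 2 * (z.factorization (q i) : ℝ) := by exact_mod_cast h1
      linarith
    · have h1 : (e' i).natAbs ≤ 2 * y.factorization (q i) := by
        simp only [he', he]; omega
      have h1' : ((e' i).natAbs : ℝ) ≤ 2 * (y.factorization (q i) : ℝ) := by exact_mod_cast h1
      linarith
  -- the per-prime estimate
  set T := x.primeFactors.filter (fun p => p₀ ≤ p) with hT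
  refine Finset.sum_le_sum fun p hp => ?_
  obtain ⟨hpx, hp₀⟩ := Finset.mem_filter.mp hp
  have hpP : p.Prime := Nat.prime_of_mem_primeFactors hpx
  haveI : Fact p.Prime := ⟨hpP⟩
  have hpdx : p ∣ x := Nat.dvd_of_mem_primeFactors hpx
  have hpyz : ¬ p ∣ y * z := fun hd =>
    hpP.one_lt.ne' (Nat.eq_one_of_dvd_coprimes hxcop hpdx hd)
  have hpz : ¬ p ∣ z := fun hd => hpyz (dvd_mul_of_dvd_right hd y)
  have hqp : ∀ i, q i ≠ p := fun i h => hpyz (h ▸ Nat.dvd_of_mem_primeFactors (hqS i))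
  -- `ord_p x ≤ ord_p ((y/z)² − 1)`
  have hval : (x.factorization p : ℤ) ≤ padicValRat p (∏ i, ((q i : ℚ)) ^ e' i - 1) := by
    rw [hΛ, padicValRat.div (by exact_mod_cast hm0) (pow_ne_zero 2 (by exact_mod_cast hz0)),
      padicValRat.pow, padicValRat.of_nat, padicValNat.eq_zero_of_not_dvd hpz]
    simp only [Nat.cast_zero, mul_zero, sub_zero]
    rw [padicValRat.of_int]
    have hdvd' : (p : ℤ) ^ x.factorization p ∣ m :=
      dvd_trans (by exact_mod_cast Nat.ordProj_dvd x p) hdvd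
    have := (padicValInt_dvd_iff _ _).mp hdvd'
    rcases this with h | h
    · exact absurd h hm0
    · exact_mod_cast h
  have hval' : (x.factorization p : ℝ) ≤ (padicValRat p (∏ i, ((q i : ℚ)) ^ e' i - 1) : ℝ) := by
    exact_mod_cast hval
  have key := hP p q e' hpP hp₀ hpdx hqP hinj himg hqp he'ne hne1 hsup
  have hlogp : 0 ≤ Real.log p := Real.log_nonneg (by exact_mod_cast hpP.one_lt.le)
  exact mul_le_mul_of_nonneg_right (hval'.trans key) hlogp

end Summit.ABC.StewartYu

end
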